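import Literature.AlgebraicGeometry.Morphisms.DevissageClass
import Mathlib.AlgebraicGeometry.Morphisms.ClosedImmersion
import Mathlib.AlgebraicGeometry.Morphisms.Finite
import HarnessLib

/-!
# Push-forwards of coherent modules along affine, finite and closed-immersion morphisms

For a morphism of schemes `i : X → Y` and a sheaf of `𝒪_X`-modules `M`, the sections of the direct
image `i_* M` (Mathlib `Scheme.Modules.pushforward i`) over `V ⊆ Y` are `Γ(i⁻¹V, M)`
(`Scheme.Modules.pushforward_obj_obj`, definitional), with `Γ(V, 𝒪_Y)` acting through
`i^* : Γ(V, 𝒪_Y) → Γ(i⁻¹V, 𝒪_X)` (`pushforward_smul`, definitional). We prove that the two halves of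
the affine-local coherence predicate `Coh` of `Literature/AlgebraicGeometry/Morphisms/DevissageClass`
(`IsAffineLocalizing`, `Modules/AffineLocalizing` = EGA I 1.4.1 d1), d2); `IsAffineFiniteType`,
`Modules/FiniteType`) pass to direct images:

* `isAffineLocalizing_pushforward_of_isAffineHom` — for `i` AFFINE, `i_* M` is affine-localizing when
  `M` is: for an affine open `V ⊆ Y` and `r ∈ Γ(V, 𝒪_Y)`, `i⁻¹V` is affine
  (`IsAffineOpen.preimage`) and `i⁻¹ D(r) = D(i^* r)` (`Scheme.preimage_basicOpen`), so the
  numerator / torsion conditions for `i_* M` on `D(r) ⊆ V` are those of `M` on `D(i^* r) ⊆ i⁻¹V`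
  (Hartshorne II Prop. 5.8 (c): `f_*` of a quasi-coherent sheaf is quasi-coherent; here in the
  elementary affine case, Hartshorne II Prop. 5.2 (d));
* `isAffineFiniteType_pushforward_of_isFinite` — for `i` FINITE, `i_* M` is of affine-finite type when
  `M` is: `Γ(i⁻¹V, M)` is finite over `Γ(i⁻¹V, 𝒪_X)`, which is a finite `Γ(V, 𝒪_Y)`-module
  (`IsAffineFiniteType.pushforward_unit`), and finiteness is transitive (`Module.Finite.trans`)
  (Hartshorne II Ex. 5.5 (c): `f_*` of coherent is coherent for `f` finite);
* `coh_pushforward_of_isFinite`, and the closed-immersion specialisations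
  `isAffineLocalizing_pushforward_of_isClosedImmersion`,
  `isAffineFiniteType_pushforward_of_isClosedImmersion`, `coh_pushforward_of_isClosedImmersion`
  (closed immersions are finite, Mathlib instance; Hartshorne II Ex. 5.5 (a), Prop. 5.8 (c)).

Everything is proved; no named facts. Mathlib searched (pin v4.32): `Scheme.Modules.pushforward_obj_obj`,
`Scheme.Modules.pushforward_obj_presheaf_map`, `IsAffineOpen.preimage`, `Scheme.preimage_basicOpen`,
`Scheme.Hom.naturality`, `Module.Finite.trans`, the instances `IsClosedImmersion → IsFinite → IsAffineHom`
(used); Mathlib has no coherence predicate for `Scheme.Modules` and no statement about direct images of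
quasi-coherent `Scheme.Modules`.

## References

* R. Hartshorne, *Algebraic Geometry*, GTM 52, Springer (1977): II Prop. 5.2 (d) (p. 111), II Prop. 5.8
  (c) (p. 115), II Ex. 5.5 (p. 124). [Hartshorne1977]
* A. Grothendieck, J. Dieudonné, *Éléments de géométrie algébrique I* (Springer, 1971), Thm. 1.4.1,
  conditions d1), d2). [folklore]
-/

noncomputable section

open CategoryTheory AlgebraicGeometry TopologicalSpace Opposite
open Literature.AlgebraicGeometry.Morphisms

universe u

namespace Literature.AlgebraicGeometry.Modules

variable {X Y : Scheme.{u}} (i : X ⟶ Y)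

/-- The scalar action on `Γ(V, i_* M) = Γ(i⁻¹V, M)`: `t • s = i^*(t) • s`. [folklore] -/
theorem pushforward_smul (M : X.Modules) (V : Y.Opens) (t : Γ(Y, V))
    (s : Γ((Scheme.Modules.pushforward i).obj M, V)) :
    t • s = (i.app V t • (show Γ(M, i ⁻¹ᵁ V) from s) : Γ(M, i ⁻¹ᵁ V)) := rfl

/-! ## Affine morphisms: `i_* M` is affine-localizing -/

/-- **`i_* M` is affine-localizing for `i` affine and `M` affine-localizing**: for an affine open
`V ⊆ Y` and `r ∈ Γ(V, 𝒪_Y)`, `i⁻¹V` is affine and `i⁻¹D(r) = D(i^* r)`, so numerators and torsion for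
`i_* M` on `D(r) ⊆ V` are those of `M` on `D(i^* r) ⊆ i⁻¹V`.
[cite: Hartshorne1977, II Prop. 5.8 (c) (p. 115) with Prop. 5.2 (d) (p. 111)] -/
theorem isAffineLocalizing_pushforward_of_isAffineHom [IsAffineHom i] {M : X.Modules}
    (hM : IsAffineLocalizing M) : IsAffineLocalizing ((Scheme.Modules.pushforward i).obj M) := by
  constructor
  · intro V hV r W hW s
    have hι : W ≤ V := hW.le.trans (Y.basicOpen_le r)
    have eW : i ⁻¹ᵁ W = X.basicOpen (i.app V r) := by rw [hW, Scheme.preimage_basicOpen]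
    obtain ⟨n, x, hx⟩ := hM.numerator (hV.preimage i) (i.app V r) eW s
    refine ⟨n, x, ?_⟩
    change M.presheaf.map ((Opens.map i.base).map (homOfLE hι)).op x =
      i.app W (Y.presheaf.map (homOfLE hι).op r ^ n) • (show Γ(M, i ⁻¹ᵁ W) from s)
    rw [map_pow, show i.app W (Y.presheaf.map (homOfLE hι).op r) =
        X.presheaf.map ((Opens.map i.base).map (homOfLE hι)).op (i.app V r) from
      ConcreteCategory.congr_hom (i.naturality (homOfLE hι).op) r]
    refine (congrArg (fun φ => M.presheaf.map φ x) (Subsingleton.elim _ _)).trans (hx.trans ?_)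
    exact congrArg (fun φ => X.presheaf.map φ (i.app V r) ^ n • (show Γ(M, i ⁻¹ᵁ W) from s))
      (Subsingleton.elim _ _)
  · intro V hV r x W hWV hrW hx
    have hD : X.basicOpen (i.app V r) ≤ i ⁻¹ᵁ W := by
      rw [← Scheme.preimage_basicOpen]; exact i.preimage_mono hrW
    have hx' : M.presheaf.map ((Opens.map i.base).map (homOfLE hWV)).op
        (show Γ(M, i ⁻¹ᵁ V) from x) = 0 := hx
    obtain ⟨n, hn⟩ := hM.torsion (hV.preimage i) (i.app V r) (show Γ(M, i ⁻¹ᵁ V) from x)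
      (i.preimage_mono hWV) hD
      ((congrArg (fun φ => M.presheaf.map φ (show Γ(M, i ⁻¹ᵁ V) from x))
        (Subsingleton.elim _ _)).trans hx')
    refine ⟨n, ?_⟩
    rw [pushforward_smul, map_pow]
    exact hn

/-! ## Finite morphisms: `i_* M` is of affine-finite type, hence coherent -/

/-- **`i_* M` is of affine-finite type for `i` finite and `M` of affine-finite type**: for an affine
open `V ⊆ Y`, `Γ(i⁻¹V, M)` is finite over `Γ(i⁻¹V, 𝒪_X)`, itself a finite `Γ(V, 𝒪_Y)`-module.
[cite: Hartshorne1977, II Ex. 5.5 (c) (p. 124)] -/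
theorem isAffineFiniteType_pushforward_of_isFinite [IsFinite i] {M : X.Modules}
    (hM : IsAffineFiniteType M) : IsAffineFiniteType ((Scheme.Modules.pushforward i).obj M) := by
  intro V hV
  haveI : Module.Finite Γ(X, i ⁻¹ᵁ V) Γ(M, i ⁻¹ᵁ V) := hM (hV.preimage i)
  letI : Algebra Γ(Y, V) Γ(X, i ⁻¹ᵁ V) := (i.app V).hom.toAlgebra
  haveI : Module.Finite Γ(Y, V) Γ(X, i ⁻¹ᵁ V) := IsAffineFiniteType.pushforward_unit i hV
  letI : Module Γ(Y, V) Γ(M, i ⁻¹ᵁ V) := Module.compHom Γ(M, i ⁻¹ᵁ V) (i.app V).hom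
  haveI : IsScalarTower Γ(Y, V) Γ(X, i ⁻¹ᵁ V) Γ(M, i ⁻¹ᵁ V) :=
    ⟨fun t a m => mul_smul (i.app V t) a m⟩
  have h : Module.Finite Γ(Y, V) Γ(M, i ⁻¹ᵁ V) := Module.Finite.trans Γ(X, i ⁻¹ᵁ V) Γ(M, i ⁻¹ᵁ V)
  exact h

/-- **`i_* M` is coherent for `i` finite and `M` coherent** (affine-localizing and of affine-finite
type). [cite: Hartshorne1977, II Ex. 5.5 (c) (p. 124) with Prop. 5.8 (c) (p. 115)] -/
theorem coh_pushforward_of_isFinite [IsFinite i] {M : X.Modules} (hM : Coh M) :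
    Coh ((Scheme.Modules.pushforward i).obj M) :=
  ⟨isAffineLocalizing_pushforward_of_isAffineHom i hM.loc,
    isAffineFiniteType_pushforward_of_isFinite i hM.ft⟩

/-! ## Closed immersions -/

/-- `i_* M` is affine-localizing for `i` a closed immersion and `M` affine-localizing.
[cite: Hartshorne1977, II Prop. 5.8 (c) (p. 115)] -/
theorem isAffineLocalizing_pushforward_of_isClosedImmersion [IsClosedImmersion i] {M : X.Modules}
    (hM : IsAffineLocalizing M) : IsAffineLocalizing ((Scheme.Modules.pushforward i).obj M) :=
  isAffineLocalizing_pushforward_of_isAffineHom i hM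

/-- `i_* M` is of affine-finite type for `i` a closed immersion and `M` of affine-finite type
(`Γ(V, 𝒪_Y) → Γ(i⁻¹V, 𝒪_X)` is surjective, in particular finite).
[cite: Hartshorne1977, II Ex. 5.5 (a), (c) (p. 124)] -/
theorem isAffineFiniteType_pushforward_of_isClosedImmersion [IsClosedImmersion i] {M : X.Modules}
    (hM : IsAffineFiniteType M) : IsAffineFiniteType ((Scheme.Modules.pushforward i).obj M) :=
  isAffineFiniteType_pushforward_of_isFinite i hM

/-- **`i_* M` is coherent for `i` a closed immersion and `M` coherent.**
[cite: Hartshorne1977, II Ex. 5.5 (p. 124) with Prop. 5.8 (c) (p. 115)] -/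
theorem coh_pushforward_of_isClosedImmersion [IsClosedImmersion i] {M : X.Modules} (hM : Coh M) :
    Coh ((Scheme.Modules.pushforward i).obj M) :=
  coh_pushforward_of_isFinite i hM

end Literature.AlgebraicGeometry.Modules

end
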